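import Mathlib
import Summits.ResolutionOfSingularities.ResolutionOfSingularities.Theorems.SyzygyFlatteningDefs
import Summits.ResolutionOfSingularities.ResolutionOfSingularities.Theorems.SyzygyFlatteningHigherRankTerminationTowerStageBasic
import Summits.ResolutionOfSingularities.ResolutionOfSingularities.Theorems.SyzygyFlatteningHigherRankTerminationLocAt
import Literature.AlgebraicGeometry.Resolution.RankOneReductionProofs
import Literature.AlgebraicGeometry.Resolution.LocalBlowup
import HarnessLib

/-!
# Normalisation commutes with localisation at a centre: `stub_nrm_locAt`

Crux `HigherRankTermination` (stmt-ResolutionOfSingularities-17045), line `birth`, registered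
stub `stub_nrm_locAt`: for a `k`-subalgebra `C ⊆ O₁` of `K`,
`locAt O₁ (nrm (locAt O₁ C)) = locAt O₁ (nrm C)`, where `nrm C = k[{y | y integral over C}]`
and `locAt O₁ C` is the localisation of `C` at the centre of `O₁` inside `K`
(`Theorems/SyzygyFlatteningDefs.lean`).

* `isIntegral_of_le`, `nrm_mono` — integrality and `nrm` are monotone in the subalgebra;
* `exists_mul_isIntegral_of_isIntegral_locAt` — an element of `K` integral over the
  localisation `locAt O₁ C` has a multiple `m * y`, `m ∈ C` an `O₁`-unit, integral over `C`
  (Mathlib's `IsIntegral.exists_multiple_integral_of_isLocalization` through the bridge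
  `locAt_toSubring_eq_locAtCentre` to the tree's `IsLocalization.AtPrime (locAtCentre _ O₁) _`);
* `nrm_locAt_le` — hence `nrm (locAt O₁ C) ≤ locAt O₁ (nrm C)`;
* `stub_nrm_locAt` — `≤` from `nrm_locAt_le`, `locAt_mono` and the idempotence `locAt_locAt`;
  `≥` from `C ≤ locAt O₁ C` and the two monotonicities.
-/

noncomputable section

-- single-problem summit: the doubled namespace component `ResolutionOfSingularities` is forced
set_option linter.dupNamespace false

namespace Summit.ResolutionOfSingularities.ResolutionOfSingularities.Theorems.SyzygyFlattening

open Literature.AlgebraicGeometry.Resolution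

variable {k K : Type} [Field k] [Field K] [Algebra k K]

/-! ## Monotonicity of `nrm` -/

/-- An element of `K` integral over a `k`-subalgebra `B` is integral over any larger one
(map the monic polynomial along the inclusion `B → C`). [folklore] -/
theorem isIntegral_of_le {B C : Subalgebra k K} (h : B ≤ C) {y : K} (hy : IsIntegral ↥B y) :
    IsIntegral ↥C y :=
  hy.map_of_comp_eq (Subalgebra.inclusion h).toRingHom (RingHom.id K) (RingHom.ext fun _ => rfl)

/-- `nrm` is monotone: `B ≤ C → nrm B ≤ nrm C`. [folklore] -/
theorem nrm_mono {B C : Subalgebra k K} (h : B ≤ C) : nrm B ≤ nrm C :=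
  Algebra.adjoin_mono fun _ hy => isIntegral_of_le h hy

/-! ## Integral elements over the localisation at a centre -/

/-- **Integrality descends from the localisation up to a unit.** If `y ∈ K` is integral over
`locAt O₁ C` (`C ⊆ O₁`), then `m * y` is integral over `C` for some `m ∈ C` with
`O₁.valuation m = 1`: `locAt O₁ C` is, as a subring, the localisation `locAtCentre C O₁` of `C`
at the centre `𝔪_{O₁} ∩ C`, and one clears denominators in a monic equation
(`IsIntegral.exists_multiple_integral_of_isLocalization`). [cite: StacksProject, Tag 0307] -/
theorem exists_mul_isIntegral_of_isIntegral_locAt (O₁ : ValuationSubring K) (C : Subalgebra k K)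
    (hC : C.toSubring ≤ O₁.toSubring) {y : K} (hy : IsIntegral ↥(locAt O₁ C) y) :
    ∃ m ∈ C, O₁.valuation m = 1 ∧ IsIntegral ↥C (m * y) := by
  haveI := isLocalization_locAtCentre (B := C.toSubring) (O := O₁) hC
  have hLC : (locAt O₁ C).toSubring = locAtCentre C.toSubring O₁ :=
    locAt_toSubring_eq_locAtCentre O₁ C hC
  -- the identity of `K` restricted: `locAt O₁ C → locAtCentre C O₁`
  let φ : ↥(locAt O₁ C) →+* ↥(locAtCentre C.toSubring O₁) :=
    { toFun := fun b => ⟨(b : K), hLC ▸ Subalgebra.mem_toSubring.mpr b.2⟩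
      map_one' := rfl
      map_mul' := fun _ _ => rfl
      map_zero' := rfl
      map_add' := fun _ _ => rfl }
  have hφ : (algebraMap ↥(locAtCentre C.toSubring O₁) K).comp φ =
      (RingHom.id K).comp (algebraMap ↥(locAt O₁ C) K) :=
    RingHom.ext fun _ => rfl
  have hy' : IsIntegral ↥(locAtCentre C.toSubring O₁) y := hy.map_of_comp_eq φ (RingHom.id K) hφ
  obtain ⟨⟨m, hm⟩, hmy⟩ := IsIntegral.exists_multiple_integral_of_isLocalization
    (subringCentre C.toSubring O₁ hC).primeCompl y hy'
  rw [Submonoid.mk_smul, Algebra.smul_def] at hmy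
  -- the identity of `K` restricted: `C.toSubring → C`
  let ψ : ↥C.toSubring →+* ↥C :=
    { toFun := fun b => ⟨(b : K), b.2⟩
      map_one' := rfl
      map_mul' := fun _ _ => rfl
      map_zero' := rfl
      map_add' := fun _ _ => rfl }
  have hψ : (algebraMap ↥C K).comp ψ = (RingHom.id K).comp (algebraMap ↥C.toSubring K) :=
    RingHom.ext fun _ => rfl
  exact ⟨(m : K), m.2, valuation_eq_one_of_not_mem_subringCentre hC hm,
    hmy.map_of_comp_eq ψ (RingHom.id K) hψ⟩

/-- **`nrm (locAt O₁ C) ≤ locAt O₁ (nrm C)`** for `C ⊆ O₁`: an element `y` integral over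
`locAt O₁ C` is `(m * y) * m⁻¹` with `m * y ∈ nrm C`, `m ∈ C ≤ nrm C` an `O₁`-unit
(`exists_mul_isIntegral_of_isIntegral_locAt`). [cite: StacksProject, Tag 0307] -/
theorem nrm_locAt_le (O₁ : ValuationSubring K) (C : Subalgebra k K)
    (hC : C.toSubring ≤ O₁.toSubring) : nrm (locAt O₁ C) ≤ locAt O₁ (nrm C) := by
  refine Algebra.adjoin_le ?_
  intro y hy
  obtain ⟨m, hmC, hv, hmy⟩ := exists_mul_isIntegral_of_isIntegral_locAt O₁ C hC hy
  have hm0 : m ≠ 0 := ne_zero_of_valuation_eq_one hv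
  have hyeq : y = m * y * m⁻¹ := by
    rw [mul_comm m y, mul_assoc, mul_inv_cancel₀ hm0, mul_one]
  rw [hyeq]
  exact mul_inv_mem_locAt O₁ (nrm C) (Algebra.subset_adjoin hmy) (self_le_nrm C hmC)
    (inv_mem_of_valuation_eq_one O₁ hv)

/-! ## The registered stub -/

/-- **STUB `stub_nrm_locAt` (normalisation commutes with localisation at a centre).** For
`C ⊆ O₁`: `locAt O₁ (nrm (locAt O₁ C)) = locAt O₁ (nrm C)` — an element integral over the
localisation `C_𝔮` has a multiple `s y`, `s ∈ C` an `O₁`-unit, integral over `C`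
(`IsIntegral.exists_multiple_integral_of_isLocalization`), whence
`nrm (locAt O₁ C) ≤ locAt O₁ (nrm C)` and `≤` follows by `locAt_mono` and the idempotence
`locAt_locAt`; `≥` is `nrm_mono (self_le_locAt O₁ C)` and `locAt_mono`.
[cite: StacksProject, Tag 0307] -/
theorem stub_nrm_locAt : ∀ (k K : Type) [Field k] [Field K] [Algebra k K]
    (O₁ : ValuationSubring K) (C : Subalgebra k K), (∀ c : k, algebraMap k K c ∈ O₁) →
      C.toSubring ≤ O₁.toSubring → locAt O₁ (nrm (locAt O₁ C)) = locAt O₁ (nrm C) := by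
  intro k K _ _ _ O₁ C hk hC
  apply le_antisymm
  · calc locAt O₁ (nrm (locAt O₁ C)) ≤ locAt O₁ (locAt O₁ (nrm C)) :=
          locAt_mono O₁ (nrm_locAt_le O₁ C hC)
      _ = locAt O₁ (nrm C) := locAt_locAt O₁ (nrm C) (nrm_toSubring_le O₁ hk hC)
  · exact locAt_mono O₁ (nrm_mono (self_le_locAt O₁ C))

end Summit.ResolutionOfSingularities.ResolutionOfSingularities.Theorems.SyzygyFlattening

end
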